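import Summits.Ventures.CertifiedManyBodySolver.Upper.BlochDressedBound
import Summits.Ventures.CertifiedManyBodySolver.Upper.BlochDressedMixtureTTPrime
import Literature.MathematicalPhysics.QuantumLattice.HubbardTorusTTPrimePlaquetteDressedBound
import HarnessLib

/-!
# Ventures/CertifiedManyBodySolver — Upper/BlochDressedBoundTTPrime.lean

HONEST FRAMING: first certified bounds; not a superconductivity verdict; every number certified or labelled float.

THE PLAQUETTE-DRESSED BLOCH BOUND FOR NON-IDEMPOTENT BLOCKS, `t–t'` MODEL (hubbard-fast-atlas-2; steps B′+C of the `t–t'` twin of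
the chain `Upper/BlochDressed*.lean`; `t' = 0` files: `Upper/BlochDressedMixture.lean` §4 and `Upper/BlochDressedBound.lean`;
theorem-only, nothing is claimed). On the torus `(ℤ/2m)²` (`m ≥ 2`, magnetic cell `k i · M i = 2m`):
* `energyDensityTT'_le_avg_dressed` — the plaquette-dressed Slater bound of the square `t–t'` torus
  (`PlaquetteLUC.groundEnergy_torusTT'_le_dressed`: plaquette terms `u_cᴴ(H_plaq + D_plaq)u_c`, axial link terms
  `V_ℓᴴ(T_e + D_e)V_ℓ`, CORNER link terms `W_ℓᴴ C_d W_ℓ` on the windows `cornerEmb`) averaged over the product-Bernoulli members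
  (`energyDensityTT'_le_avg_of_slaterBound`);
* **`energyDensityTT'_le_dressed_bloch`** — the average replaced by the value at `P_Q = spinBlock (σ ↦ blochMatrix Q_σ)` with the
  decorrelation errors of the THREE window families (`norm_sum_prodWeight_mul_sum_windowObservable_sub_le`, generic in the chart):
  `e(t,t',U;n̄) ≤ re 𝒟ᵗᵗ'_u(P_Q)/(2m)² + [(Σ_c‖·‖₁)K₈ + (Σ_ℓ‖·‖₁)K₁₆ + (Σ_ℓ'‖·‖₁)K₁₆]/(2m)² + (16|t| + 32|t'|)/(2m)`, `K_w = 2^w w! 2w²/|k|`.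
Sources: Bach–Lieb–Solovej 1994 (2c.36) [BachLiebSolovej1994]; Lieb 1981 [Lieb1981]. Everything is proved; no definition.
-/

noncomputable section

namespace Summit.Ventures.CertifiedManyBodySolver.Upper

open Matrix Finset
open Literature.MathematicalPhysics.QuantumLattice Literature.MathematicalPhysics.QuantumLattice.HartreeFock
  Literature.MathematicalPhysics.QuantumLattice.ThermodynamicLimit HubbardWave0 PlaquetteLUC
open scoped ComplexOrder ComplexConjugate

variable {m : ℕ} [NeZero m] {k M : Fin 2 → ℕ} [∀ i, NeZero (k i)] [∀ i, NeZero (M i)]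

/-! ### §1. The dressed Slater bound averaged over the members -/

/-- **The plaquette-dressed Slater bound of the `t–t'` torus, averaged over the product-Bernoulli members.** On `(ℤ/2m)²` (`m ≥ 2`)
tiled by `m²` plaquettes, for every family of number-conserving plaquette unitaries `u_c`, blocks `Q σ κ` with spectra in `[0,1]`,
`n̄ ∈ (0,2)`, `U ≥ 0`, real `t'`: `e(t,t',U;n̄) ≤ (Σ_E W(E) · re 𝒟ᵗᵗ'_u(P_E))/(2m)² + (16|t| + 32|t'|)/(2m)` with `𝒟ᵗᵗ'_u` the dressed
functional of `PlaquetteLUC.groundEnergy_torusTT'_le_dressed` (plaquette, axial-link and corner-link terms). [cite: BachLiebSolovej1994, eq. (2c.36)] -/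
theorem energyDensityTT'_le_avg_dressed (hm : 2 ≤ m) (hkM : ∀ i, k i * M i = m * 2) (t t' : ℝ) {U : ℝ} (hU : 0 ≤ U)
    (Q : Fin 2 → RectTorusSite k → Matrix (RectTorusSite M) (RectTorusSite M) ℂ) (hQh : ∀ σ κ, (Q σ κ).IsHermitian)
    (h0 : ∀ σ κ i, 0 ≤ (hQh σ κ).eigenvalues i) (h1 : ∀ σ κ i, (hQh σ κ).eigenvalues i ≤ 1)
    (hn0 : 0 < (∑ σ, ∑ κ, (Q σ κ).trace).re / ((m * 2 : ℕ) : ℝ) ^ 2)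
    (hn2 : (∑ σ, ∑ κ, (Q σ κ).trace).re / ((m * 2 : ℕ) : ℝ) ^ 2 < 2)
    (u : (Fin 2 → Fin m) → Matrix (Finset (Orb (FermionTorus 2 2))) (Finset (Orb (FermionTorus 2 2))) ℂ)
    (hu : ∀ c, (u c)ᴴ * u c = 1) (huN : ∀ c, Commute totalNumberOp (u c)) :
    energyDensityTT' t t' U ((∑ σ, ∑ κ, (Q σ κ).trace).re / ((m * 2 : ℕ) : ℝ) ^ 2) ≤
      (∑ E : Fin 2 × RectTorusSite k → RectTorusSite M → Bool,
          (∏ b : Fin 2 × RectTorusSite k, bernoulliWeight (hQh b.1 b.2) (E b)) *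
          ((∑ c : Fin 2 → Fin m, ∑ s : Finset (Orb (FermionTorus 2 2)), ∑ s' : Finset (Orb (FermionTorus 2 2)),
              ((u c)ᴴ * (hamiltonian plaquetteGraph t U + hamiltonian plaquetteDiagGraph t' 0) * u c) s s' *
                slaterRDM ((spinBlock fun σ => blochMatrix hkM fun κ => bernoulliProj (hQh σ κ) (E (σ, κ))).submatrix
                  (fun a => orb (cellEmb c (ofLex a).1) (ofLex a).2) (fun a => orb (cellEmb c (ofLex a).1) (ofLex a).2)) s s') +
            (∑ ℓ : (Fin 2 → Fin m) × Fin 2, ∑ s : Finset (Orb (Fin 2 ×ₗ FermionTorus 2 2)),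
              ∑ s' : Finset (Orb (Fin 2 ×ₗ FermionTorus 2 2)),
                ((fermionEmbed inlCell (u ℓ.1) * fermionEmbed inrCell (u (shiftCell ℓ.1 ℓ.2)))ᴴ *
                    (hamiltonian (linkGraph ℓ.2) t 0 + hamiltonian (linkDiagGraph ℓ.2) t' 0) *
                  (fermionEmbed inlCell (u ℓ.1) * fermionEmbed inrCell (u (shiftCell ℓ.1 ℓ.2)))) s s' *
                slaterRDM ((spinBlock fun σ => blochMatrix hkM fun κ => bernoulliProj (hQh σ κ) (E (σ, κ))).submatrix
                  (fun a => orb (linkEmb hm ℓ.1 ℓ.2 (ofLex a).1) (ofLex a).2)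
                  (fun a => orb (linkEmb hm ℓ.1 ℓ.2 (ofLex a).1) (ofLex a).2)) s s' +
              ∑ ℓ : (Fin 2 → Fin m) × Fin 2, ∑ s : Finset (Orb (Fin 2 ×ₗ FermionTorus 2 2)),
                ∑ s' : Finset (Orb (Fin 2 ×ₗ FermionTorus 2 2)),
                  ((fermionEmbed inlCell (u ℓ.1) * fermionEmbed inrCell (u (cornerShift ℓ.1 ℓ.2)))ᴴ *
                      hamiltonian (cornerGraph ℓ.2) t' 0 *
                    (fermionEmbed inlCell (u ℓ.1) * fermionEmbed inrCell (u (cornerShift ℓ.1 ℓ.2)))) s s' *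
                  slaterRDM ((spinBlock fun σ => blochMatrix hkM fun κ => bernoulliProj (hQh σ κ) (E (σ, κ))).submatrix
                    (fun a => orb (cornerEmb hm ℓ.1 ℓ.2 (ofLex a).1) (ofLex a).2)
                    (fun a => orb (cornerEmb hm ℓ.1 ℓ.2 (ofLex a).1) (ofLex a).2)) s s')).re) / ((m * 2 : ℕ) : ℝ) ^ 2 +
        (16 * |t| + 32 * |t'|) / ((m * 2 : ℕ) : ℝ) := by
  have hL : 3 ≤ m * 2 := by omega
  have hLe : Even (m * 2) := ⟨m, by ring⟩
  haveI : NeZero (m * 2) := ⟨by omega⟩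
  refine energyDensityTT'_le_avg_of_slaterBound hkM hL hLe t t' hU Q hQh h0 h1 hn0 hn2
    (fun P : Matrix (Orb (FermionTorus 2 (m * 2))) (Orb (FermionTorus 2 (m * 2))) ℂ =>
      ((∑ c : Fin 2 → Fin m, ∑ s : Finset (Orb (FermionTorus 2 2)), ∑ s' : Finset (Orb (FermionTorus 2 2)),
          ((u c)ᴴ * (hamiltonian plaquetteGraph t U + hamiltonian plaquetteDiagGraph t' 0) * u c) s s' *
            slaterRDM (P.submatrix (fun a => orb (cellEmb c (ofLex a).1) (ofLex a).2)
              (fun a => orb (cellEmb c (ofLex a).1) (ofLex a).2)) s s') +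
        (∑ ℓ : (Fin 2 → Fin m) × Fin 2, ∑ s : Finset (Orb (Fin 2 ×ₗ FermionTorus 2 2)),
          ∑ s' : Finset (Orb (Fin 2 ×ₗ FermionTorus 2 2)),
            ((fermionEmbed inlCell (u ℓ.1) * fermionEmbed inrCell (u (shiftCell ℓ.1 ℓ.2)))ᴴ *
                (hamiltonian (linkGraph ℓ.2) t 0 + hamiltonian (linkDiagGraph ℓ.2) t' 0) *
              (fermionEmbed inlCell (u ℓ.1) * fermionEmbed inrCell (u (shiftCell ℓ.1 ℓ.2)))) s s' *
            slaterRDM (P.submatrix (fun a => orb (linkEmb hm ℓ.1 ℓ.2 (ofLex a).1) (ofLex a).2)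
              (fun a => orb (linkEmb hm ℓ.1 ℓ.2 (ofLex a).1) (ofLex a).2)) s s' +
          ∑ ℓ : (Fin 2 → Fin m) × Fin 2, ∑ s : Finset (Orb (Fin 2 ×ₗ FermionTorus 2 2)),
            ∑ s' : Finset (Orb (Fin 2 ×ₗ FermionTorus 2 2)),
              ((fermionEmbed inlCell (u ℓ.1) * fermionEmbed inrCell (u (cornerShift ℓ.1 ℓ.2)))ᴴ *
                  hamiltonian (cornerGraph ℓ.2) t' 0 *
                (fermionEmbed inlCell (u ℓ.1) * fermionEmbed inrCell (u (cornerShift ℓ.1 ℓ.2)))) s s' *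
              slaterRDM (P.submatrix (fun a => orb (cornerEmb hm ℓ.1 ℓ.2 (ofLex a).1) (ofLex a).2)
                (fun a => orb (cornerEmb hm ℓ.1 ℓ.2 (ofLex a).1) (ofLex a).2)) s s')).re)
    fun P hP hPP N htr => ?_
  exact groundEnergy_torusTT'_le_dressed hm t t' U hP hPP htr u hu huN

/-! ### §2. Decorrelation: the average replaced by the value at `P_Q` -/

set_option maxHeartbeats 800000 in
/-- **The plaquette-dressed Bloch bound for non-idempotent blocks, `t–t'` model.** On `(ℤ/2m)²`, `m ≥ 2`, magnetic cell
`k i · M i = 2m`, blocks `Q σ κ` with spectra in `[0,1]`, `n̄ = re Σ tr Q σ κ /(2m)² ∈ (0,2)`, `U ≥ 0`, real `t'`,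
number-conserving plaquette unitaries `u_c`:
`e(t,t',U;n̄) ≤ re 𝒟ᵗᵗ'_u(P_Q)/(2m)² + [(Σ_c ‖u_cᴴ (H_plaq+D_plaq) u_c‖₁) K₈ + (Σ_ℓ ‖V_ℓᴴ (T_e+D_e) V_ℓ‖₁) K₁₆ + (Σ_ℓ' ‖W_ℓ'ᴴ C_d W_ℓ'‖₁) K₁₆]/(2m)²
  + (16|t| + 32|t'|)/(2m)` with `K_w = 2^w w! 2w²/|k|`. (Member bounds averaged over the product-Bernoulli mixture, then decorrelation
cluster family by cluster family.) [cite: BachLiebSolovej1994, eq. (2c.36)] -/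
theorem energyDensityTT'_le_dressed_bloch (hm : 2 ≤ m) (hkM : ∀ i, k i * M i = m * 2) (t t' : ℝ) {U : ℝ} (hU : 0 ≤ U)
    (Q : Fin 2 → RectTorusSite k → Matrix (RectTorusSite M) (RectTorusSite M) ℂ) (hQh : ∀ σ κ, (Q σ κ).IsHermitian)
    (h0 : ∀ σ κ i, 0 ≤ (hQh σ κ).eigenvalues i) (h1 : ∀ σ κ i, (hQh σ κ).eigenvalues i ≤ 1)
    (hn0 : 0 < (∑ σ, ∑ κ, (Q σ κ).trace).re / ((m * 2 : ℕ) : ℝ) ^ 2)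
    (hn2 : (∑ σ, ∑ κ, (Q σ κ).trace).re / ((m * 2 : ℕ) : ℝ) ^ 2 < 2)
    (u : (Fin 2 → Fin m) → Matrix (Finset (Orb (FermionTorus 2 2))) (Finset (Orb (FermionTorus 2 2))) ℂ)
    (hu : ∀ c, (u c)ᴴ * u c = 1) (huN : ∀ c, Commute totalNumberOp (u c)) :
    energyDensityTT' t t' U ((∑ σ, ∑ κ, (Q σ κ).trace).re / ((m * 2 : ℕ) : ℝ) ^ 2) ≤
      ((∑ c : Fin 2 → Fin m, ∑ s : Finset (Orb (FermionTorus 2 2)), ∑ s' : Finset (Orb (FermionTorus 2 2)),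
            ((u c)ᴴ * (hamiltonian plaquetteGraph t U + hamiltonian plaquetteDiagGraph t' 0) * u c) s s' *
              slaterRDM ((spinBlock fun σ => blochMatrix hkM (Q σ)).submatrix
                (fun a => orb (cellEmb c (ofLex a).1) (ofLex a).2) (fun a => orb (cellEmb c (ofLex a).1) (ofLex a).2)) s s') +
          (∑ ℓ : (Fin 2 → Fin m) × Fin 2, ∑ s : Finset (Orb (Fin 2 ×ₗ FermionTorus 2 2)), ∑ s' : Finset (Orb (Fin 2 ×ₗ FermionTorus 2 2)),
            ((fermionEmbed inlCell (u ℓ.1) * fermionEmbed inrCell (u (shiftCell ℓ.1 ℓ.2)))ᴴ *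
                (hamiltonian (linkGraph ℓ.2) t 0 + hamiltonian (linkDiagGraph ℓ.2) t' 0) *
                (fermionEmbed inlCell (u ℓ.1) * fermionEmbed inrCell (u (shiftCell ℓ.1 ℓ.2)))) s s' *
              slaterRDM ((spinBlock fun σ => blochMatrix hkM (Q σ)).submatrix
                (fun a => orb (linkEmb hm ℓ.1 ℓ.2 (ofLex a).1) (ofLex a).2) (fun a => orb (linkEmb hm ℓ.1 ℓ.2 (ofLex a).1) (ofLex a).2)) s s' +
            ∑ ℓ : (Fin 2 → Fin m) × Fin 2, ∑ s : Finset (Orb (Fin 2 ×ₗ FermionTorus 2 2)), ∑ s' : Finset (Orb (Fin 2 ×ₗ FermionTorus 2 2)),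
              ((fermionEmbed inlCell (u ℓ.1) * fermionEmbed inrCell (u (cornerShift ℓ.1 ℓ.2)))ᴴ * hamiltonian (cornerGraph ℓ.2) t' 0 *
                  (fermionEmbed inlCell (u ℓ.1) * fermionEmbed inrCell (u (cornerShift ℓ.1 ℓ.2)))) s s' *
                slaterRDM ((spinBlock fun σ => blochMatrix hkM (Q σ)).submatrix
                  (fun a => orb (cornerEmb hm ℓ.1 ℓ.2 (ofLex a).1) (ofLex a).2)
                  (fun a => orb (cornerEmb hm ℓ.1 ℓ.2 (ofLex a).1) (ofLex a).2)) s s')).re /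
          ((m * 2 : ℕ) : ℝ) ^ 2 +
        ((∑ c : Fin 2 → Fin m, ∑ s : Finset (Orb (FermionTorus 2 2)), ∑ s' : Finset (Orb (FermionTorus 2 2)),
              ‖((u c)ᴴ * (hamiltonian plaquetteGraph t U + hamiltonian plaquetteDiagGraph t' 0) * u c) s s'‖) *
            (2 ^ Fintype.card (Orb (FermionTorus 2 2)) * ((Fintype.card (Orb (FermionTorus 2 2))).factorial *
              (2 * (Fintype.card (Orb (FermionTorus 2 2)) : ℝ) ^ 2 / (Fintype.card (RectTorusSite k) : ℝ)))) +
          ((∑ ℓ : (Fin 2 → Fin m) × Fin 2, ∑ s : Finset (Orb (Fin 2 ×ₗ FermionTorus 2 2)), ∑ s' : Finset (Orb (Fin 2 ×ₗ FermionTorus 2 2)),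
              ‖((fermionEmbed inlCell (u ℓ.1) * fermionEmbed inrCell (u (shiftCell ℓ.1 ℓ.2)))ᴴ *
                  (hamiltonian (linkGraph ℓ.2) t 0 + hamiltonian (linkDiagGraph ℓ.2) t' 0) *
                (fermionEmbed inlCell (u ℓ.1) * fermionEmbed inrCell (u (shiftCell ℓ.1 ℓ.2)))) s s'‖) *
            (2 ^ Fintype.card (Orb (Fin 2 ×ₗ FermionTorus 2 2)) * ((Fintype.card (Orb (Fin 2 ×ₗ FermionTorus 2 2))).factorial *
              (2 * (Fintype.card (Orb (Fin 2 ×ₗ FermionTorus 2 2)) : ℝ) ^ 2 / (Fintype.card (RectTorusSite k) : ℝ)))) +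
          (∑ ℓ : (Fin 2 → Fin m) × Fin 2, ∑ s : Finset (Orb (Fin 2 ×ₗ FermionTorus 2 2)), ∑ s' : Finset (Orb (Fin 2 ×ₗ FermionTorus 2 2)),
              ‖((fermionEmbed inlCell (u ℓ.1) * fermionEmbed inrCell (u (cornerShift ℓ.1 ℓ.2)))ᴴ * hamiltonian (cornerGraph ℓ.2) t' 0 *
                (fermionEmbed inlCell (u ℓ.1) * fermionEmbed inrCell (u (cornerShift ℓ.1 ℓ.2)))) s s'‖) *
            (2 ^ Fintype.card (Orb (Fin 2 ×ₗ FermionTorus 2 2)) * ((Fintype.card (Orb (Fin 2 ×ₗ FermionTorus 2 2))).factorial *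
              (2 * (Fintype.card (Orb (Fin 2 ×ₗ FermionTorus 2 2)) : ℝ) ^ 2 / (Fintype.card (RectTorusSite k) : ℝ)))))) /
          ((m * 2 : ℕ) : ℝ) ^ 2 +
        (16 * |t| + 32 * |t'|) / ((m * 2 : ℕ) : ℝ) := by
  have havg := energyDensityTT'_le_avg_dressed hm hkM t t' hU Q hQh h0 h1 hn0 hn2 u hu huN
  have hL2 : (0 : ℝ) < ((m * 2 : ℕ) : ℝ) ^ 2 := by
    have : (0 : ℝ) < ((m * 2 : ℕ) : ℝ) := by exact_mod_cast (show 0 < m * 2 by omega)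
    positivity
  -- abbreviations for the coefficient matrices, the windows and the three cluster sums
  obtain ⟨Xc, hXc⟩ : ∃ Xc : (Fin 2 → Fin m) → Matrix (Finset (Orb (FermionTorus 2 2))) (Finset (Orb (FermionTorus 2 2))) ℂ,
      Xc = fun c => (u c)ᴴ * (hamiltonian plaquetteGraph t U + hamiltonian plaquetteDiagGraph t' 0) * u c := ⟨_, rfl⟩
  obtain ⟨Yl, hYl⟩ : ∃ Yl : (Fin 2 → Fin m) × Fin 2 →
      Matrix (Finset (Orb (Fin 2 ×ₗ FermionTorus 2 2))) (Finset (Orb (Fin 2 ×ₗ FermionTorus 2 2))) ℂ,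
      Yl = fun ℓ => (fermionEmbed inlCell (u ℓ.1) * fermionEmbed inrCell (u (shiftCell ℓ.1 ℓ.2)))ᴴ *
        (hamiltonian (linkGraph ℓ.2) t 0 + hamiltonian (linkDiagGraph ℓ.2) t' 0) *
        (fermionEmbed inlCell (u ℓ.1) * fermionEmbed inrCell (u (shiftCell ℓ.1 ℓ.2))) := ⟨_, rfl⟩
  obtain ⟨Zl, hZl⟩ : ∃ Zl : (Fin 2 → Fin m) × Fin 2 →
      Matrix (Finset (Orb (Fin 2 ×ₗ FermionTorus 2 2))) (Finset (Orb (Fin 2 ×ₗ FermionTorus 2 2))) ℂ,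
      Zl = fun ℓ => (fermionEmbed inlCell (u ℓ.1) * fermionEmbed inrCell (u (cornerShift ℓ.1 ℓ.2)))ᴴ *
        hamiltonian (cornerGraph ℓ.2) t' 0 *
        (fermionEmbed inlCell (u ℓ.1) * fermionEmbed inrCell (u (cornerShift ℓ.1 ℓ.2))) := ⟨_, rfl⟩
  obtain ⟨fc, hfc⟩ : ∃ fc : (Fin 2 → Fin m) → Orb (FermionTorus 2 2) → Orb (FermionTorus 2 (m * 2)),
      fc = fun c a => orb (cellEmb c (ofLex a).1) (ofLex a).2 := ⟨_, rfl⟩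
  obtain ⟨fl, hfl⟩ : ∃ fl : (Fin 2 → Fin m) × Fin 2 → Orb (Fin 2 ×ₗ FermionTorus 2 2) → Orb (FermionTorus 2 (m * 2)),
      fl = fun ℓ a => orb (linkEmb hm ℓ.1 ℓ.2 (ofLex a).1) (ofLex a).2 := ⟨_, rfl⟩
  obtain ⟨fn, hfn⟩ : ∃ fn : (Fin 2 → Fin m) × Fin 2 → Orb (Fin 2 ×ₗ FermionTorus 2 2) → Orb (FermionTorus 2 (m * 2)),
      fn = fun ℓ a => orb (cornerEmb hm ℓ.1 ℓ.2 (ofLex a).1) (ofLex a).2 := ⟨_, rfl⟩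
  have eXc : ∀ c, (u c)ᴴ * (hamiltonian plaquetteGraph t U + hamiltonian plaquetteDiagGraph t' 0) * u c = Xc c := fun c => by
    rw [hXc]
  have eYl : ∀ ℓ : (Fin 2 → Fin m) × Fin 2,
      (fermionEmbed inlCell (u ℓ.1) * fermionEmbed inrCell (u (shiftCell ℓ.1 ℓ.2)))ᴴ *
        (hamiltonian (linkGraph ℓ.2) t 0 + hamiltonian (linkDiagGraph ℓ.2) t' 0) *
        (fermionEmbed inlCell (u ℓ.1) * fermionEmbed inrCell (u (shiftCell ℓ.1 ℓ.2))) = Yl ℓ := fun ℓ => by rw [hYl]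
  have eZl : ∀ ℓ : (Fin 2 → Fin m) × Fin 2,
      (fermionEmbed inlCell (u ℓ.1) * fermionEmbed inrCell (u (cornerShift ℓ.1 ℓ.2)))ᴴ * hamiltonian (cornerGraph ℓ.2) t' 0 *
        (fermionEmbed inlCell (u ℓ.1) * fermionEmbed inrCell (u (cornerShift ℓ.1 ℓ.2))) = Zl ℓ := fun ℓ => by rw [hZl]
  have efc : ∀ c, (fun a : Orb (FermionTorus 2 2) => orb (cellEmb c (ofLex a).1) (ofLex a).2) = fc c := fun c => by rw [hfc]
  have efl : ∀ ℓ : (Fin 2 → Fin m) × Fin 2,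
      (fun a : Orb (Fin 2 ×ₗ FermionTorus 2 2) => orb (linkEmb hm ℓ.1 ℓ.2 (ofLex a).1) (ofLex a).2) = fl ℓ := fun ℓ => by rw [hfl]
  have efn : ∀ ℓ : (Fin 2 → Fin m) × Fin 2,
      (fun a : Orb (Fin 2 ×ₗ FermionTorus 2 2) => orb (cornerEmb hm ℓ.1 ℓ.2 (ofLex a).1) (ofLex a).2) = fn ℓ := fun ℓ => by rw [hfn]
  simp_rw [eXc, eYl, eZl, efc, efl, efn] at havg ⊢
  -- the three decorrelation bounds
  have hcells := norm_sum_prodWeight_mul_sum_windowObservable_sub_le hkM Q hQh h0 h1 fc Xc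
  have hlinks := norm_sum_prodWeight_mul_sum_windowObservable_sub_le hkM Q hQh h0 h1 fl Yl
  have hcorners := norm_sum_prodWeight_mul_sum_windowObservable_sub_le hkM Q hQh h0 h1 fn Zl
  -- abbreviate the averaged quantities
  obtain ⟨W, hW⟩ : ∃ W : (Fin 2 × RectTorusSite k → RectTorusSite M → Bool) → ℝ,
      W = fun E => ∏ b : Fin 2 × RectTorusSite k, bernoulliWeight (hQh b.1 b.2) (E b) := ⟨_, rfl⟩
  obtain ⟨A, hA⟩ : ∃ A : (Fin 2 × RectTorusSite k → RectTorusSite M → Bool) → ℂ, A = fun E =>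
      ∑ c, ∑ s : Finset (Orb (FermionTorus 2 2)), ∑ s' : Finset (Orb (FermionTorus 2 2)), Xc c s s' *
        slaterRDM ((spinBlock fun σ => blochMatrix hkM fun κ => bernoulliProj (hQh σ κ) (E (σ, κ))).submatrix (fc c) (fc c)) s s' :=
    ⟨_, rfl⟩
  obtain ⟨B, hB⟩ : ∃ B : (Fin 2 × RectTorusSite k → RectTorusSite M → Bool) → ℂ, B = fun E =>
      ∑ ℓ, ∑ s : Finset (Orb (Fin 2 ×ₗ FermionTorus 2 2)), ∑ s' : Finset (Orb (Fin 2 ×ₗ FermionTorus 2 2)), Yl ℓ s s' *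
        slaterRDM ((spinBlock fun σ => blochMatrix hkM fun κ => bernoulliProj (hQh σ κ) (E (σ, κ))).submatrix (fl ℓ) (fl ℓ)) s s' :=
    ⟨_, rfl⟩
  obtain ⟨C, hC⟩ : ∃ C : (Fin 2 × RectTorusSite k → RectTorusSite M → Bool) → ℂ, C = fun E =>
      ∑ ℓ, ∑ s : Finset (Orb (Fin 2 ×ₗ FermionTorus 2 2)), ∑ s' : Finset (Orb (Fin 2 ×ₗ FermionTorus 2 2)), Zl ℓ s s' *
        slaterRDM ((spinBlock fun σ => blochMatrix hkM fun κ => bernoulliProj (hQh σ κ) (E (σ, κ))).submatrix (fn ℓ) (fn ℓ)) s s' :=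
    ⟨_, rfl⟩
  obtain ⟨AQ, hAQ⟩ : ∃ AQ : ℂ, AQ = ∑ c, ∑ s : Finset (Orb (FermionTorus 2 2)), ∑ s' : Finset (Orb (FermionTorus 2 2)), Xc c s s' *
      slaterRDM ((spinBlock fun σ => blochMatrix hkM (Q σ)).submatrix (fc c) (fc c)) s s' := ⟨_, rfl⟩
  obtain ⟨BQ, hBQ⟩ : ∃ BQ : ℂ, BQ = ∑ ℓ, ∑ s : Finset (Orb (Fin 2 ×ₗ FermionTorus 2 2)), ∑ s' : Finset (Orb (Fin 2 ×ₗ FermionTorus 2 2)),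
      Yl ℓ s s' * slaterRDM ((spinBlock fun σ => blochMatrix hkM (Q σ)).submatrix (fl ℓ) (fl ℓ)) s s' := ⟨_, rfl⟩
  obtain ⟨CQ, hCQ⟩ : ∃ CQ : ℂ, CQ = ∑ ℓ, ∑ s : Finset (Orb (Fin 2 ×ₗ FermionTorus 2 2)), ∑ s' : Finset (Orb (Fin 2 ×ₗ FermionTorus 2 2)),
      Zl ℓ s s' * slaterRDM ((spinBlock fun σ => blochMatrix hkM (Q σ)).submatrix (fn ℓ) (fn ℓ)) s s' := ⟨_, rfl⟩
  obtain ⟨K₁, hK₁⟩ : ∃ K₁ : ℝ, K₁ = (∑ c, ∑ s : Finset (Orb (FermionTorus 2 2)), ∑ s' : Finset (Orb (FermionTorus 2 2)), ‖Xc c s s'‖) *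
      (2 ^ Fintype.card (Orb (FermionTorus 2 2)) * ((Fintype.card (Orb (FermionTorus 2 2))).factorial *
        (2 * (Fintype.card (Orb (FermionTorus 2 2)) : ℝ) ^ 2 / (Fintype.card (RectTorusSite k) : ℝ)))) := ⟨_, rfl⟩
  obtain ⟨K₂, hK₂⟩ : ∃ K₂ : ℝ, K₂ = (∑ ℓ : (Fin 2 → Fin m) × Fin 2, ∑ s : Finset (Orb (Fin 2 ×ₗ FermionTorus 2 2)),
      ∑ s' : Finset (Orb (Fin 2 ×ₗ FermionTorus 2 2)), ‖Yl ℓ s s'‖) *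
      (2 ^ Fintype.card (Orb (Fin 2 ×ₗ FermionTorus 2 2)) * ((Fintype.card (Orb (Fin 2 ×ₗ FermionTorus 2 2))).factorial *
        (2 * (Fintype.card (Orb (Fin 2 ×ₗ FermionTorus 2 2)) : ℝ) ^ 2 / (Fintype.card (RectTorusSite k) : ℝ)))) := ⟨_, rfl⟩
  obtain ⟨K₃, hK₃⟩ : ∃ K₃ : ℝ, K₃ = (∑ ℓ : (Fin 2 → Fin m) × Fin 2, ∑ s : Finset (Orb (Fin 2 ×ₗ FermionTorus 2 2)),
      ∑ s' : Finset (Orb (Fin 2 ×ₗ FermionTorus 2 2)), ‖Zl ℓ s s'‖) *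
      (2 ^ Fintype.card (Orb (Fin 2 ×ₗ FermionTorus 2 2)) * ((Fintype.card (Orb (Fin 2 ×ₗ FermionTorus 2 2))).factorial *
        (2 * (Fintype.card (Orb (Fin 2 ×ₗ FermionTorus 2 2)) : ℝ) ^ 2 / (Fintype.card (RectTorusSite k) : ℝ)))) := ⟨_, rfl⟩
  have hWc : ∀ E : Fin 2 × RectTorusSite k → RectTorusSite M → Bool,
      (∏ b : Fin 2 × RectTorusSite k, (bernoulliWeight (hQh b.1 b.2) (E b) : ℂ)) = ((W E : ℝ) : ℂ) := fun E => by
    rw [hW]; push_cast; rfl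
  have hWE : ∀ E : Fin 2 × RectTorusSite k → RectTorusSite M → Bool,
      (∏ b : Fin 2 × RectTorusSite k, bernoulliWeight (hQh b.1 b.2) (E b)) = W E := fun E => by rw [hW]
  have hAE : ∀ E : Fin 2 × RectTorusSite k → RectTorusSite M → Bool,
      (∑ c, ∑ s : Finset (Orb (FermionTorus 2 2)), ∑ s' : Finset (Orb (FermionTorus 2 2)), Xc c s s' *
        slaterRDM ((spinBlock fun σ => blochMatrix hkM fun κ => bernoulliProj (hQh σ κ) (E (σ, κ))).submatrix (fc c) (fc c)) s s') =
      A E := fun E => by rw [hA]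
  have hBE : ∀ E : Fin 2 × RectTorusSite k → RectTorusSite M → Bool,
      (∑ ℓ, ∑ s : Finset (Orb (Fin 2 ×ₗ FermionTorus 2 2)), ∑ s' : Finset (Orb (Fin 2 ×ₗ FermionTorus 2 2)), Yl ℓ s s' *
        slaterRDM ((spinBlock fun σ => blochMatrix hkM fun κ => bernoulliProj (hQh σ κ) (E (σ, κ))).submatrix (fl ℓ) (fl ℓ)) s s') =
      B E := fun E => by rw [hB]
  have hCE : ∀ E : Fin 2 × RectTorusSite k → RectTorusSite M → Bool,
      (∑ ℓ, ∑ s : Finset (Orb (Fin 2 ×ₗ FermionTorus 2 2)), ∑ s' : Finset (Orb (Fin 2 ×ₗ FermionTorus 2 2)), Zl ℓ s s' *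
        slaterRDM ((spinBlock fun σ => blochMatrix hkM fun κ => bernoulliProj (hQh σ κ) (E (σ, κ))).submatrix (fn ℓ) (fn ℓ)) s s') =
      C E := fun E => by rw [hC]
  simp_rw [hWc, hAE] at hcells
  simp_rw [hWc, hBE] at hlinks
  simp_rw [hWc, hCE] at hcorners
  simp_rw [hWE, hAE, hBE, hCE] at havg
  rw [← hAQ, ← hK₁] at hcells
  rw [← hBQ, ← hK₂] at hlinks
  rw [← hCQ, ← hK₃] at hcorners
  rw [← hAQ, ← hBQ, ← hCQ, ← hK₁, ← hK₂, ← hK₃]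
  -- compare the average with the value at `P_Q`
  have hre : ∑ E, W E * (A E + (B E + C E)).re =
      ((AQ + (BQ + CQ)) + (((∑ E, ((W E : ℝ) : ℂ) * A E) - AQ) + (((∑ E, ((W E : ℝ) : ℂ) * B E) - BQ) +
        ((∑ E, ((W E : ℝ) : ℂ) * C E) - CQ)))).re := by
    have : (AQ + (BQ + CQ)) + (((∑ E, ((W E : ℝ) : ℂ) * A E) - AQ) + (((∑ E, ((W E : ℝ) : ℂ) * B E) - BQ) +
        ((∑ E, ((W E : ℝ) : ℂ) * C E) - CQ))) = ∑ E, ((W E : ℝ) : ℂ) * (A E + (B E + C E)) := by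
      simp_rw [mul_add]
      rw [Finset.sum_add_distrib, Finset.sum_add_distrib]
      ring
    rw [this, Complex.re_sum]
    exact Finset.sum_congr rfl fun E _ => by rw [Complex.re_ofReal_mul]
  have hbound : ∑ E, W E * (A E + (B E + C E)).re ≤ (AQ + (BQ + CQ)).re + (K₁ + (K₂ + K₃)) := by
    rw [hre, Complex.add_re]
    have h := Complex.re_le_norm (((∑ E, ((W E : ℝ) : ℂ) * A E) - AQ) + (((∑ E, ((W E : ℝ) : ℂ) * B E) - BQ) +
      ((∑ E, ((W E : ℝ) : ℂ) * C E) - CQ)))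
    have h' := norm_add_le ((∑ E, ((W E : ℝ) : ℂ) * A E) - AQ) (((∑ E, ((W E : ℝ) : ℂ) * B E) - BQ) +
      ((∑ E, ((W E : ℝ) : ℂ) * C E) - CQ))
    have h'' := norm_add_le ((∑ E, ((W E : ℝ) : ℂ) * B E) - BQ) ((∑ E, ((W E : ℝ) : ℂ) * C E) - CQ)
    linarith
  have hdiv := div_le_div_of_nonneg_right hbound hL2.le
  rw [add_div] at hdiv
  linarith

end Summit.Ventures.CertifiedManyBodySolver.Upper
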